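/-
  Summits/AtomisticToContinuum/Crystallization/Theorems/OverbindingBudgetAffineFarCoreShells.lean

  residual stmt-AtomisticToContinuum-31280 · slot Z · leaf LAB₁′ `ShelteredShellLabelling'` (leaf list v14′, critic rows 890/899; engine
  LAB₁′ ⟸ R_aff′ ∧ BBI₀ ∧ CORE): tool-box for CORE `CoreRechart (1/25)`, part 3 — FIRST SHELLS MATCH (♠) and the ORIGIN ISOMETRY: the
  matched first shells of the two distorted stackings determine a linear isometry `U` of `ℝ³` (K2 `barlowShell_relabelling_rigidity`)
  with `Φ_c ≈ Φ_b ∘ U` to first order (A1 `norm_map_le_of_unit_frame`).  decomp-a2c lens-4 «minimal counterexample / extremal reduction»,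
  generation 58.  Imports C2 `…FarCoreIdentification`, A1 `…FarFirstShellCompanions`, K2 `…FarKissingRigidity`.
  0 sorry · 0 axiom · no instance · no notation · no option.
-/
import Summits.AtomisticToContinuum.Crystallization.Theorems.OverbindingBudgetAffineFarCoreIdentification
import Summits.AtomisticToContinuum.Crystallization.Theorems.OverbindingBudgetAffineFarFirstShellCompanions
import Summits.AtomisticToContinuum.Crystallization.Theorems.OverbindingBudgetAffineFarKissingRigidity

/-! # CORE tool-box 3: first shells match, and the origin isometry (PROVED)

Setting (file docstring of C2): `X = 𝓛(t)`, `Z = basedImage V s p₀` (`p₀` a site of `𝓛(s)`), charts `Φ_c = a • B`, `Φ_b = a₀ • B₀` with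
`(22/25)‖v‖ ≤ ‖B v‖, ‖B₀ v‖ ≤ (28/25)‖v‖`, accuracy `ε` with `12ε < a`, `12ε < a₀`.
* §1 the norm-one points of `Z` are `V '' barlowShell (s k₀) (−s(k₀−1))` (`p₀` in layer `k₀`); the norm-one sites of `X` are its origin shell.
* §2 (♠) FIRST SHELLS MATCH: if the origin shell of `X` is matched into `Z` and the norm-one points of `Z` are matched into `X`, every
  origin-shell vector of `X` has a NORM-ONE partner — by the `√2`-gap when `a ≤ a₀`, and by counting (an injection between two `12`-sets
  is onto) when `a₀ < a`.
* §3 ORIGIN ISOMETRY: K2 turns the partner map into a linear isometry `U` (`108 η₀² < 1` with `η₀ = 25ε/(22a₀)`), and A1's unit tetrahedral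
  frame gives `‖Φ_c v − Φ_b (U v)‖ ≤ 3ε‖v‖`.
-/

namespace Summit.AtomisticToContinuum.Crystallization.Theorems.OverbindingBudgetAffineFarSmoothSplit

open scoped BigOperators RealInnerProductSpace
open Literature.MathematicalPhysics.StatisticalMechanics
open Literature.Geometry.DiscreteGeometry (layerSpacing layerShell hexagonSet holeTriple mem_layerShell_iff hexagonSet_subset_layerShell)

/-! ## §1  Norm-one points (PROVED) -/

/-- The sites of `𝓛(t)` at distance `1` from the site `barlowPos 1 √(2/3) t k i j` are its contact shell. [BarlowTexturedSet] -/
theorem sub_mem_barlowShell_of_dist_eq_one {t : ℤ → ℤ} (ht : IsHaggSeq t) (k i j : ℤ) {q : EuclideanSpace ℝ (Fin 3)}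
    (hq : q ∈ barlowStacking 1 (Real.sqrt (2 / 3)) t) (hd : dist q (barlowPos 1 (Real.sqrt (2 / 3)) t k i j) = 1) :
    q - barlowPos 1 (Real.sqrt (2 / 3)) t k i j ∈ barlowShell (t k : ℝ) (-((t (k - 1) : ℤ) : ℝ)) := by
  have h := touching_barlowStacking_eq_image_barlowShell ht k i j
  have hmem : q ∈ {x | x ∈ barlowStacking 1 (Real.sqrt (2 / 3)) t ∧ dist x (barlowPos 1 (Real.sqrt (2 / 3)) t k i j) = 1} := ⟨hq, hd⟩
  rw [h] at hmem
  obtain ⟨v, hv, hvq⟩ := hmem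
  simp only at hvq
  rw [← hvq, add_sub_cancel_left]; exact hv

/-- The norm-one sites of `𝓛(t)` form its origin shell. [BarlowTexturedSet] -/
theorem mem_originShell_of_norm_eq_one {t : ℤ → ℤ} (ht : IsHaggSeq t) {x : EuclideanSpace ℝ (Fin 3)}
    (hx : x ∈ barlowStacking 1 (Real.sqrt (2 / 3)) t) (h1 : ‖x‖ = 1) : x ∈ barlowShell (t 0 : ℝ) (-((t (0 - 1) : ℤ) : ℝ)) := by
  have h0 : barlowPos 1 (Real.sqrt (2 / 3)) t 0 0 0 = 0 := by simp [barlowPos]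
  have h := sub_mem_barlowShell_of_dist_eq_one ht 0 0 0 hx (by rw [h0, dist_zero_right, h1])
  rwa [h0, sub_zero] at h

/-- The norm-one points of `Z = basedImage V s p₀`, `p₀ = barlowPos 1 √(2/3) s k₀ i₀ j₀`, are `V`-images of the contact shell at `p₀`. [this file] -/
theorem mem_image_shell_of_norm_eq_one {s : ℤ → ℤ} (hs : IsHaggSeq s) (V : EuclideanSpace ℝ (Fin 3) →ₗᵢ[ℝ] EuclideanSpace ℝ (Fin 3))
    (k₀ i₀ j₀ : ℤ) {z : EuclideanSpace ℝ (Fin 3)} (hz : z ∈ basedImage V s (barlowPos 1 (Real.sqrt (2 / 3)) s k₀ i₀ j₀)) (h1 : ‖z‖ = 1) :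
    z ∈ V '' barlowShell (s k₀ : ℝ) (-((s (k₀ - 1) : ℤ) : ℝ)) := by
  obtain ⟨q, hq, rfl⟩ := hz
  rw [V.norm_map, ← dist_eq_norm] at h1
  exact ⟨_, sub_mem_barlowShell_of_dist_eq_one hs k₀ i₀ j₀ hq h1, rfl⟩

/-- `V`-images of the contact shell at the base site are norm-one points of `Z`. [this file] -/
theorem image_shell_mem {s : ℤ → ℤ} (hs : IsHaggSeq s) (V : EuclideanSpace ℝ (Fin 3) →ₗᵢ[ℝ] EuclideanSpace ℝ (Fin 3)) (k₀ i₀ j₀ : ℤ)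
    {v : EuclideanSpace ℝ (Fin 3)} (hv : v ∈ barlowShell (s k₀ : ℝ) (-((s (k₀ - 1) : ℤ) : ℝ))) :
    V v ∈ basedImage V s (barlowPos 1 (Real.sqrt (2 / 3)) s k₀ i₀ j₀) ∧ ‖V v‖ = 1 := by
  refine ⟨⟨_, barlowPos_add_mem_of_mem_barlowShell hs k₀ i₀ j₀ hv, by simp⟩, ?_⟩
  rw [V.norm_map, norm_eq_one_of_mem_barlowShell (cast_letter_eq hs k₀) (neg_cast_letter_eq hs (k₀ - 1)) hv]

/-! ## §2  First shells match (♠) (PROVED) -/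

/-- Norm bookkeeping for a matched pair: `a (22/25)‖x‖ ≤ a₀ (28/25)‖ζ‖ + ε` and `a₀ (22/25)‖ζ‖ ≤ a (28/25)‖x‖ + ε`. [this file] -/
theorem matched_norm_bounds {B B₀ : EuclideanSpace ℝ (Fin 3) →ₗ[ℝ] EuclideanSpace ℝ (Fin 3)} {a a₀ ε : ℝ} (ha : 0 < a) (ha₀ : 0 < a₀)
    (hlo : ∀ v, 22 / 25 * ‖v‖ ≤ ‖B v‖) (hhi : ∀ v, ‖B v‖ ≤ 28 / 25 * ‖v‖)
    (hlo₀ : ∀ v, 22 / 25 * ‖v‖ ≤ ‖B₀ v‖) (hhi₀ : ∀ v, ‖B₀ v‖ ≤ 28 / 25 * ‖v‖) {x ζ : EuclideanSpace ℝ (Fin 3)}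
    (hm : ‖a • B x - a₀ • B₀ ζ‖ ≤ ε) :
    a * (22 / 25 * ‖x‖) ≤ a₀ * (28 / 25 * ‖ζ‖) + ε ∧ a₀ * (22 / 25 * ‖ζ‖) ≤ a * (28 / 25 * ‖x‖) + ε := by
  have n1 : ‖a • B x‖ = a * ‖B x‖ := by rw [norm_smul, Real.norm_eq_abs, abs_of_pos ha]
  have n2 : ‖a₀ • B₀ ζ‖ = a₀ * ‖B₀ ζ‖ := by rw [norm_smul, Real.norm_eq_abs, abs_of_pos ha₀]
  have t1 : ‖a • B x‖ ≤ ‖a₀ • B₀ ζ‖ + ‖a • B x - a₀ • B₀ ζ‖ := norm_le_insert' _ _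
  have t2 : ‖a₀ • B₀ ζ‖ ≤ ‖a • B x‖ + ‖a • B x - a₀ • B₀ ζ‖ := by rw [norm_sub_rev] ; exact norm_le_insert' _ _
  rw [n1, n2] at t1 t2
  constructor
  · nlinarith [hlo x, hhi₀ ζ, ha.le, ha₀.le]
  · nlinarith [hlo₀ ζ, hhi x, ha.le, ha₀.le]

/-- **(♠) FIRST SHELLS MATCH (PROVED).**  If every origin-shell vector of `X = 𝓛(t)` is matched into `Z` and every norm-one point of
`Z` is matched into `X` (`12ε < a`, `12ε < a₀`), then every origin-shell vector of `X` has a norm-one partner in `Z`. [this file] -/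
theorem exists_norm_one_partner {t s : ℤ → ℤ} (ht : IsHaggSeq t) (hs : IsHaggSeq s) {p₀ : EuclideanSpace ℝ (Fin 3)}
    (hp₀ : p₀ ∈ barlowStacking 1 (Real.sqrt (2 / 3)) s) (V : EuclideanSpace ℝ (Fin 3) →ₗᵢ[ℝ] EuclideanSpace ℝ (Fin 3))
    {B B₀ : EuclideanSpace ℝ (Fin 3) →ₗ[ℝ] EuclideanSpace ℝ (Fin 3)} {a a₀ ε : ℝ} (ha : 0 < a) (ha₀ : 0 < a₀)
    (hlo : ∀ v, 22 / 25 * ‖v‖ ≤ ‖B v‖) (hhi : ∀ v, ‖B v‖ ≤ 28 / 25 * ‖v‖)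
    (hlo₀ : ∀ v, 22 / 25 * ‖v‖ ≤ ‖B₀ v‖) (hhi₀ : ∀ v, ‖B₀ v‖ ≤ 28 / 25 * ‖v‖)
    (hεa : 12 * ε < a) (hεa₀ : 12 * ε < a₀)
    (hMX : ∀ x ∈ barlowShell (t 0 : ℝ) (-((t (0 - 1) : ℤ) : ℝ)), ∃ z ∈ basedImage V s p₀, ‖a • B x - a₀ • B₀ z‖ ≤ ε)
    (hMZ : ∀ z ∈ basedImage V s p₀, ‖z‖ = 1 → ∃ x ∈ barlowStacking 1 (Real.sqrt (2 / 3)) t, ‖a • B x - a₀ • B₀ z‖ ≤ ε) :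
    ∀ e ∈ barlowShell (t 0 : ℝ) (-((t (0 - 1) : ℤ) : ℝ)), ∃ ζ ∈ basedImage V s p₀, ‖ζ‖ = 1 ∧ ‖a • B e - a₀ • B₀ ζ‖ ≤ ε := by
  classical
  have hσ := cast_letter_eq ht 0
  have hτ := neg_cast_letter_eq ht (0 - 1)
  obtain ⟨k₀, i₀, j₀, hp₀eq⟩ := id hp₀
  have hσ' := cast_letter_eq hs k₀
  have hτ' := neg_cast_letter_eq hs (k₀ - 1)
  have h72 : (7 / 5 : ℝ) < Real.sqrt 2 := (by rw [show (7 / 5 : ℝ) = Real.sqrt ((7 / 5) ^ 2) by rw [Real.sqrt_sq (by norm_num)]]; exact Real.sqrt_lt_sqrt (by norm_num) (by norm_num) : (7 / 5 : ℝ) < Real.sqrt 2)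
  rcases le_or_gt a a₀ with hle | hlt
  · -- `a ≤ a₀`: the partner is nonzero and has norm `< √2`, hence norm `1`
    intro e he
    obtain ⟨ζ, hζ, hm⟩ := hMX e he
    refine ⟨ζ, hζ, ?_, hm⟩
    have he1 : ‖e‖ = 1 := norm_eq_one_of_mem_barlowShell hσ hτ he
    obtain ⟨b1, b2⟩ := matched_norm_bounds ha ha₀ hlo hhi hlo₀ hhi₀ hm
    rw [he1] at b1 b2
    have hζlt : ‖ζ‖ < 7 / 5 := by
      by_contra hge; push Not at hge; nlinarith
    have hζ0 : ζ ≠ 0 := by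
      rintro rfl
      rw [norm_zero] at b1
      nlinarith
    obtain ⟨q, hq, hqζ⟩ := mem_basedImage_iff.1 hζ
    have hqd : ‖ζ‖ = dist q p₀ := by rw [← hqζ, V.norm_map, dist_eq_norm]
    have hlt2 : dist q p₀ < Real.sqrt 2 := by rw [← hqd]; linarith
    have hne : q ≠ p₀ := by
      intro h; apply hζ0; rw [← hqζ, h, sub_self, map_zero]
    rcases eq_or_dist_eq_one hs hq hp₀ hlt2 with h | h
    · exact absurd h hne
    · rw [hqd, h]
  · -- `a₀ < a`: partners of the norm-one points of `Z` are origin-shell vectors; the partner map is injective between `12`-sets, so onto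
    have hP : ∀ ζ ∈ V '' barlowShell (s k₀ : ℝ) (-((s (k₀ - 1) : ℤ) : ℝ)),
        ∃ x ∈ barlowShell (t 0 : ℝ) (-((t (0 - 1) : ℤ) : ℝ)), ‖a • B x - a₀ • B₀ ζ‖ ≤ ε := by
      rintro ζ ⟨v, hv, rfl⟩
      obtain ⟨hζZ, hζ1⟩ := image_shell_mem hs V k₀ i₀ j₀ hv
      rw [← hp₀eq] at hζZ
      obtain ⟨x, hx, hm⟩ := hMZ _ hζZ hζ1
      refine ⟨x, ?_, hm⟩
      obtain ⟨b1, b2⟩ := matched_norm_bounds ha ha₀ hlo hhi hlo₀ hhi₀ hm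
      rw [hζ1] at b1 b2
      have hx0 : x ≠ 0 := by
        rintro rfl
        rw [norm_zero] at b2
        nlinarith
      have hxlt : ‖x‖ < Real.sqrt 2 := by
        have : ‖x‖ < 7 / 5 := by
          by_contra hge; push Not at hge; nlinarith
        linarith
      rcases norm_eq_one_or_sqrt_two_le ht hx hx0 with h1 | h2
      · exact mem_originShell_of_norm_eq_one ht hx h1
      · exact absurd h2 (not_le.2 hxlt)
    choose F hFX hFm using hP
    have hinj : ∀ ζ₁ ζ₂ (h₁ : ζ₁ ∈ V '' barlowShell (s k₀ : ℝ) (-((s (k₀ - 1) : ℤ) : ℝ)))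
        (h₂ : ζ₂ ∈ V '' barlowShell (s k₀ : ℝ) (-((s (k₀ - 1) : ℤ) : ℝ))), F ζ₁ h₁ = F ζ₂ h₂ → ζ₁ = ζ₂ := by
      intro ζ₁ ζ₂ h₁ h₂ heq
      obtain ⟨v₁, hv₁, rfl⟩ := h₁
      obtain ⟨v₂, hv₂, rfl⟩ := h₂
      have m1 := hFm _ ⟨v₁, hv₁, rfl⟩
      have m2 := hFm _ ⟨v₂, hv₂, rfl⟩
      rw [heq] at m1
      have hd : ‖a₀ • B₀ (V v₁) - a₀ • B₀ (V v₂)‖ ≤ 2 * ε := by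
        have e : a₀ • B₀ (V v₁) - a₀ • B₀ (V v₂) =
            (a • B (F (V v₂) ⟨v₂, hv₂, rfl⟩) - a₀ • B₀ (V v₂)) - (a • B (F (V v₂) ⟨v₂, hv₂, rfl⟩) - a₀ • B₀ (V v₁)) := by abel
        rw [e]
        exact (norm_sub_le _ _).trans (by linarith)
      rw [← smul_sub, ← map_sub, norm_smul, Real.norm_eq_abs, abs_of_pos ha₀] at hd
      have hlow := hlo₀ (V v₁ - V v₂)
      have hz1 := (image_shell_mem hs V k₀ i₀ j₀ hv₁).1
      have hz2 := (image_shell_mem hs V k₀ i₀ j₀ hv₂).1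
      refine basedImage_eq_of_dist_lt_one hs hz1 hz2 ?_
      rw [dist_eq_norm]
      by_contra hge; push Not at hge
      nlinarith
    have hcard : (barlowShell (t 0 : ℝ) (-((t (0 - 1) : ℤ) : ℝ))).ncard ≤ (V '' barlowShell (s k₀ : ℝ) (-((s (k₀ - 1) : ℤ) : ℝ))).ncard := by
      rw [Set.ncard_image_of_injective _ V.injective, ncard_barlowShell hσ hτ, ncard_barlowShell hσ' hτ']
    have hsurj := Set.surj_on_of_inj_on_of_ncard_le F hFX hinj hcard (finite_barlowShell _ _)
    intro e he
    obtain ⟨ζ, hζ, heq⟩ := hsurj e he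
    obtain ⟨v, hv, rfl⟩ := id hζ
    obtain ⟨hζZ, hζ1⟩ := image_shell_mem hs V k₀ i₀ j₀ hv
    rw [← hp₀eq] at hζZ
    exact ⟨V v, hζZ, hζ1, heq ▸ hFm _ hζ⟩

/-! ## §3  The origin isometry (PROVED) -/

/-- **ORIGIN ISOMETRY (PROVED).**  In the setting of §2 there is a linear isometry `U` of `ℝ³` carrying every origin-shell vector `e` of
`X` to a partner `U e ∈ Z` (`‖Φ_c e − Φ_b (U e)‖ ≤ ε`), with `‖Φ_c v − Φ_b (U v)‖ ≤ 3ε‖v‖` for all `v`.  (K2 `barlowShell_relabelling_rigidity`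
with `T = (a/a₀) B₀⁻¹ B`, `η₀ = 25ε/(22a₀)`, `108η₀² < 1`; then A1 `norm_map_le_of_unit_frame` on a unit tetrahedral frame of the origin
shell.) [this file] -/
theorem exists_origin_isometry {t s : ℤ → ℤ} (ht : IsHaggSeq t) (hs : IsHaggSeq s) {p₀ : EuclideanSpace ℝ (Fin 3)}
    (hp₀ : p₀ ∈ barlowStacking 1 (Real.sqrt (2 / 3)) s) (V : EuclideanSpace ℝ (Fin 3) →ₗᵢ[ℝ] EuclideanSpace ℝ (Fin 3))
    {B B₀ : EuclideanSpace ℝ (Fin 3) →ₗ[ℝ] EuclideanSpace ℝ (Fin 3)} {a a₀ ε : ℝ} (ha : 0 < a) (ha₀ : 0 < a₀)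
    (hlo : ∀ v, 22 / 25 * ‖v‖ ≤ ‖B v‖) (hhi : ∀ v, ‖B v‖ ≤ 28 / 25 * ‖v‖)
    (hlo₀ : ∀ v, 22 / 25 * ‖v‖ ≤ ‖B₀ v‖) (hhi₀ : ∀ v, ‖B₀ v‖ ≤ 28 / 25 * ‖v‖)
    (hε0 : 0 ≤ ε) (hεa : 12 * ε < a) (hεa₀ : 12 * ε < a₀)
    (hMX : ∀ x ∈ barlowShell (t 0 : ℝ) (-((t (0 - 1) : ℤ) : ℝ)), ∃ z ∈ basedImage V s p₀, ‖a • B x - a₀ • B₀ z‖ ≤ ε)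
    (hMZ : ∀ z ∈ basedImage V s p₀, ‖z‖ = 1 → ∃ x ∈ barlowStacking 1 (Real.sqrt (2 / 3)) t, ‖a • B x - a₀ • B₀ z‖ ≤ ε) :
    ∃ U : EuclideanSpace ℝ (Fin 3) ≃ₗᵢ[ℝ] EuclideanSpace ℝ (Fin 3),
      (∀ e ∈ barlowShell (t 0 : ℝ) (-((t (0 - 1) : ℤ) : ℝ)), U e ∈ basedImage V s p₀ ∧ ‖a • B e - a₀ • B₀ (U e)‖ ≤ ε) ∧
      ∀ v, ‖a • B v - a₀ • B₀ (U v)‖ ≤ 3 * ε * ‖v‖ := by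
  classical
  have hσ := cast_letter_eq ht 0
  have hτ := neg_cast_letter_eq ht (0 - 1)
  obtain ⟨k₀, i₀, j₀, hp₀eq⟩ := id hp₀
  have hσ' := cast_letter_eq hs k₀
  have hτ' := neg_cast_letter_eq hs (k₀ - 1)
  -- (♠) partner map
  have spade := exists_norm_one_partner ht hs hp₀ V ha ha₀ hlo hhi hlo₀ hhi₀ hεa hεa₀ hMX hMZ
  choose! G hGZ hG1 hGm using spade
  -- `B₀⁻¹`
  have hinj₀ : Function.Injective B₀ := by
    intro u v huv
    have h := hlo₀ (u - v)
    rw [map_sub, huv, sub_self, norm_zero] at h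
    have : ‖u - v‖ = 0 := le_antisymm (by linarith) (norm_nonneg _)
    exact sub_eq_zero.mp (norm_eq_zero.mp this)
  set E := LinearEquiv.ofInjectiveEndo B₀ hinj₀ with hE
  have hEapp : ∀ v, E v = B₀ v := fun v => rfl
  have hEinv : ∀ u, ‖E.symm u‖ ≤ 25 / 22 * ‖u‖ := by
    intro u
    have h := hlo₀ (E.symm u)
    rw [← hEapp, E.apply_symm_apply] at h
    linarith
  -- the comparison linear map `T = (a/a₀) B₀⁻¹ B`
  set T : EuclideanSpace ℝ (Fin 3) →ₗ[ℝ] EuclideanSpace ℝ (Fin 3) := (a₀⁻¹ * a) • ((E.symm : _ →ₗ[ℝ] _) ∘ₗ B) with hT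
  have hTapp : ∀ v, T v = E.symm ((a₀⁻¹ * a) • B v) := by
    intro v; rw [hT, LinearMap.smul_apply, LinearMap.comp_apply, LinearEquiv.coe_coe, LinearEquiv.map_smul]
  have hclose : ∀ x ∈ barlowShell (t 0 : ℝ) (-((t (0 - 1) : ℤ) : ℝ)), ‖G x - T x‖ ≤ 25 * ε / (22 * a₀) := by
    intro x hx
    have e1 : G x - T x = E.symm (B₀ (G x) - (a₀⁻¹ * a) • B x) := by
      rw [map_sub, ← hEapp, E.symm_apply_apply, hTapp]
    have e2 : B₀ (G x) - (a₀⁻¹ * a) • B x = a₀⁻¹ • (a₀ • B₀ (G x) - a • B x) := by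
      rw [smul_sub, smul_smul, inv_mul_cancel₀ ha₀.ne', one_smul, smul_smul]
    rw [e1]
    refine (hEinv _).trans ?_
    rw [e2, norm_smul, Real.norm_eq_abs, abs_of_pos (inv_pos.2 ha₀), norm_sub_rev]
    rw [show 25 * ε / (22 * a₀) = 25 / 22 * (a₀⁻¹ * ε) by field_simp]
    exact mul_le_mul_of_nonneg_left (mul_le_mul_of_nonneg_left (hGm x hx) (inv_pos.2 ha₀).le) (by norm_num)
  have hη₀ : 108 * (25 * ε / (22 * a₀)) ^ 2 < 1 := by
    rw [div_pow, ← lt_div_iff₀' (by norm_num : (0 : ℝ) < 108)] 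
    rw [div_lt_iff₀ (by positivity)]
    nlinarith [hεa₀, hε0, ha₀]
  have hmaps : Set.MapsTo G (barlowShell (t 0 : ℝ) (-((t (0 - 1) : ℤ) : ℝ))) (V '' barlowShell (s k₀ : ℝ) (-((s (k₀ - 1) : ℤ) : ℝ))) := by
    intro x hx
    exact mem_image_shell_of_norm_eq_one hs V k₀ i₀ j₀ (hp₀eq ▸ hGZ x hx) (hG1 x hx)
  obtain ⟨U₀, hU₀⟩ := barlowShell_relabelling_rigidity hσ hτ hσ' hτ' V T G hmaps hclose hη₀
  set U := U₀.toLinearIsometryEquiv rfl with hU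
  have hUapp : ∀ v, U v = U₀ v := fun v => rfl
  have hUG : ∀ e ∈ barlowShell (t 0 : ℝ) (-((t (0 - 1) : ℤ) : ℝ)), U e = G e := fun e he => by rw [hUapp, hU₀ e he]
  refine ⟨U, fun e he => ⟨by rw [hUG e he]; exact hGZ e he, by rw [hUG e he]; exact hGm e he⟩, ?_⟩
  -- first-order closeness on a unit tetrahedral frame of the origin shell (A1)
  have hu : triangularVec₁ (2 : ℝ) ∈ layerShell (t 0 : ℝ) (-((t (0 - 1) : ℤ) : ℝ)) :=
    hexagonSet_subset_layerShell _ _ (by simp [hexagonSet])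
  obtain ⟨W₁, hW₁, W₂, hW₂, h01, h02, h12⟩ := exists_tetrahedral_companions hσ hτ hu
  have mf : ∀ W ∈ layerShell (t 0 : ℝ) (-((t (0 - 1) : ℤ) : ℝ)), (2 : ℝ)⁻¹ • W ∈ barlowShell (t 0 : ℝ) (-((t (0 - 1) : ℤ) : ℝ)) :=
    fun W hW => ⟨W, hW, rfl⟩
  have nf : ∀ W ∈ layerShell (t 0 : ℝ) (-((t (0 - 1) : ℤ) : ℝ)), ‖(2 : ℝ)⁻¹ • W‖ = 1 :=
    fun W hW => norm_eq_one_of_mem_barlowShell hσ hτ (mf W hW)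
  have ipf : ∀ W W' : EuclideanSpace ℝ (Fin 3), ⟪W, W'⟫ = (2 : ℝ) → ⟪(2 : ℝ)⁻¹ • W, (2 : ℝ)⁻¹ • W'⟫ = 1 / 2 := by
    intro W W' h; rw [real_inner_smul_left, real_inner_smul_right, h]; norm_num
  set A : EuclideanSpace ℝ (Fin 3) →ₗ[ℝ] EuclideanSpace ℝ (Fin 3) := a • B - (a₀ • B₀) ∘ₗ (U.toLinearEquiv : _ →ₗ[ℝ] _) with hA
  have hAapp : ∀ v, A v = a • B v - a₀ • B₀ (U v) := by
    intro v
    rw [hA, LinearMap.sub_apply, LinearMap.smul_apply, LinearMap.comp_apply, LinearMap.smul_apply]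
    rfl
  have hb : ∀ W ∈ layerShell (t 0 : ℝ) (-((t (0 - 1) : ℤ) : ℝ)), ‖A ((2 : ℝ)⁻¹ • W)‖ ≤ ε := by
    intro W hW; rw [hAapp, hUG _ (mf W hW)]; exact hGm _ (mf W hW)
  intro v
  rw [← hAapp]
  exact norm_map_le_of_unit_frame A (nf _ hu) (nf _ hW₁) (nf _ hW₂) (ipf _ _ h01) (ipf _ _ h02) (ipf _ _ h12)
    (hb _ hu) (hb _ hW₁) (hb _ hW₂) v

end Summit.AtomisticToContinuum.Crystallization.Theorems.OverbindingBudgetAffineFarSmoothSplit
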